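import Summits.ABC.IUTFork.Cor312Ind2BallsRamified
import Literature.IUT.LogVolume.LatticeAutStableSubgroups
import Literature.IUT.LogVolume.LogRadius
import Literature.IUT.LogVolume.RescaledCompletionInvariants
import HarnessLib

/-!
# [IUTchIII] Cor. 3.12, TEAM R `indFixes` thread: the BALL-MOVER CRITERION for the Dupuy–Hilado (Ind2) group
# `Real.ismDH` at EVERY finite place — `t·𝒪_v` is fixed by all of (Ind2) iff `t·𝒪_v ∈ p^ℤ·log_p(𝒪_v^×)`

PROOF-ONLY file (0 definitions, 0 named facts) of the abc-iut cell (WAVE-5 prover seat abc-iut-w5-d180, gen 4;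
TEAM R «ismDH mover» thread, successor item (i) of abc-iut-w5-d216's chain p421508/p422813/p427624/p427994/
p428821/p429240 «movers at `e ≥ 3` / wild places; expected criterion `e ≥ 2 ∧ ord_v(tq_v) ≢ 1 (mod e)` via
`GL(I_v)`-transitivity»); TAKES NO SIDE on [IUTchIII] Cor. 3.12.

SETTING.  `F` a number field, `v | p` finite, `K_v` = abc-iut-S7's `RescaledCompletion F p v` (c312-5's carrier
`Real.Carrier (inr v)` is the same type, `toR`/`ofR` the identity), `logv` the analytic logarithm over `p`
(`LogvAnalyticAt`; e.g. `Real.analyticLogv`), so that `I_v = (p^*)⁻¹·log_p(𝒪_v^×)` (c312-5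
`mem_shell_iff_mem_smul_logUnits`).  Dupuy–Hilado's (Ind2) at `v` (arXiv:2004.13228 §4.9 «`ℚ_p`-vector space
automorphisms which arise as `ℤ_p`-lattice isomorphisms of `I_v`») is c312-5's `Real.ismDH logv (inr v)`.  The
one-factor `q`-pilot hull-sets are the balls `t·𝒪_v = {‖y‖ ≤ ‖t‖}` ([IUTchIII] Rmk. 3.9.5 (i); p427624 §2).

RESULTS (classical lattice algebra, Weil *BNT* II §2, via campaign-S `LatticeAutOrbits`/`LatticeAutStableSubgroups`:
the `Aut_{ℚ_p}(K : Λ)`-stable lattices are exactly `p^ℤ·Λ`):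
* §1–2 dictionary `Real.ismDH logv (inr v)` ↔ `Aut_{ℚ_p}(K_v : log_p(𝒪_v^×))` (continuity ⇒ `ℚ_p`-linearity,
  campaign-S `map_padic_smul_of_continuous`);
* §3 **`forall_ismDH_image_closedBall_eq_iff`** (`t ≠ 0`): EVERY `g ∈ Real.ismDH logv (inr v)` maps `{‖y‖ ≤ ‖t‖}`
  onto itself **iff** `{‖y‖ ≤ ‖t‖} = p^k·log_p(𝒪_v^×)` for some `k ∈ ℤ` — any residue characteristic, any
  ramification; a ball that is no `p^k·log_p(𝒪_v^×)` IS MOVED (`exists_mem_ismDH_image_closedBall_ne_of_forall_ne`);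
* §4 without computing `log_p(𝒪_v^×)`: two (Ind2)-fixed balls have radii in ratio `p^ℤ`; for a uniformizer `ϖ`
  and `e(v|p) ∤ i`, of `t·𝒪_v` and `t·ϖ^i·𝒪_v` at least one is moved; so at EVERY ramified place (`e(v|p) ≥ 2`,
  wild included), for EVERY `t ≠ 0`, `t·𝒪_v` or `t·ϖ·𝒪_v` is moved (refines abc-iut-c312-5's p429534);
* §5 TAME EVALUATION (`p > 2`, `e(v|p) ≤ p − 2`, any `f`): `log_p(𝒪_v^×) = 𝔪_v` (campaign-S `prop12iEq_holds`,
  [IUTchIV] Prop. 1.2 (i)), so **`forall_ismDH_image_closedBall_eq_iff_dvd`**: `𝔪_v^j` is (Ind2)-fixed iff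
  `e(v|p) ∣ (j − 1)` — **`t·𝒪_v` is MOVED iff `ord_v(t) ≢ 1 (mod e(v|p))`**, w5-d216's predicted criterion at every
  tame `e ≥ 2` and every `f` (p421508: `e = 2`, `f = 1`, `p ≥ 5`); at `e(v|p) = 1`, `p` odd, no ball is moved.

HONEST FRAMING.  Statements about Dupuy–Hilado's typed (Ind2) group acting on one-factor hull-sets; which reading
of [IUTchIII] Thm. 3.11 (i) (Ind2) is print's, and anything about Cor. 3.12, is for the referee lanes / the R-lane
record.  [cite: DupuyHilado2025, §4.9] [cite: WeilBNT1967, Ch. II §2, Th. 1–2] [cite: NeukirchANT1999, Ch. II Prop. (5.5)]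
[claim: Mochizuki2012, status: disputed] for every [IUTchIII]/[IUTchIV] locution.  Consumed BY NAME, nothing
restated: `Real.ismDH`, `toR`/`ofR`, `mem_shell_iff_mem_smul_logUnits`, `LogvAnalyticAt`,
`finiteDimensional_rescaledCompletion` (c312-5), `RescaledCompletion`, `absRamificationIdx_rescaledCompletion` (S7),
`exists_adaptedBasis`, `logUnits`, `prop12iEq_holds`, `map_padic_smul_of_continuous` (campaign S), `PadicModule.*`.
-/

noncomputable section

open Set Metric NumberField IsDedekindDomain
open scoped Pointwise

namespace Summit.ABC.IUTFork.Thm311.Real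

open Cor312Vol Literature.IUT.LogThetaLattice Literature.IUT.LogVolume Literature.NumberTheory.NumberFields
open Literature.NumberTheory.GaloisRepresentations.Ultrametric

variable {F : Type} [Field F] [NumberField F] {p : ℕ} [hp : Fact p.Prime]
variable {logv : PadicLogs F} (hlog : LogvAnalyticAt p logv)
variable (v : HeightOneSpectrum (𝓞 F)) (hv : ((p : ℕ) : 𝓞 F) ∈ v.asIdeal)

/-! ## 1. `log_p(𝒪_v^×)` is the lattice of a basis of `K_v/ℚ_p` -/

/-- `log_p(𝒪_v^×)` is the `ℤ_p`-lattice of some `ℚ_p`-basis of the rescaled completion (campaign-S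
`exists_adaptedBasis`: it is compact and open). [cite: WeilBNT1967, Ch. II §2, Th. 1] -/
theorem exists_basis_coe_logUnits_eq :
    ∃ (n : ℕ) (_ : Nonempty (Fin n)) (B : Module.Basis (Fin n) ℚ_[p] (RescaledCompletion F p v hv)),
      (logUnits (RescaledCompletion F p v hv) : Set (RescaledCompletion F p v hv)) =
        (PadicModule.basisLattice p B : Set (RescaledCompletion F p v hv)) := by
  set K := RescaledCompletion F p v hv
  obtain ⟨n, bZ, b, c, hn, -, hM⟩ := exists_adaptedBasis p (logUnitsAddSubgroup p K)
    (isOpen_logUnits p K) (isCompact_logUnits p K)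
  refine ⟨n, ⟨⟨0, hn⟩⟩, b.unitsSMul c, ?_⟩
  ext x
  rw [← PadicModule.boxLattice_eq_basisLattice_unitsSMul, SetLike.mem_coe, ← hM x]
  rfl

include hlog

/-! ## 2. The dictionary `Real.ismDH logv (inr v)` ↔ `Aut_{ℚ_p}(K_v : log_p(𝒪_v^×))` -/

section Dictionary

variable {v hv}
variable {n : ℕ} (B : Module.Basis (Fin n) ℚ_[p] (RescaledCompletion F p v hv))
  (hΛ : (logUnits (RescaledCompletion F p v hv) : Set (RescaledCompletion F p v hv)) =
    (PadicModule.basisLattice p B : Set (RescaledCompletion F p v hv)))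

include hΛ

/-- **Lattice automorphisms are (Ind2)-elements**: every `ℚ_p`-linear automorphism `φ` of `K_v` with
`φ(log_p(𝒪_v^×)) = log_p(𝒪_v^×)`, re-read as a `ℚ`-linear map of c312-5's carrier, is bicontinuous (finite
dimension) and fixes `I_v = (p^*)⁻¹·log_p(𝒪_v^×)`: it lies in `Real.ismDH logv (inr v)` and acts as `φ`
(abc-iut-c312-5's construction in p429534, isolated). [cite: DupuyHilado2025, §4.9] -/
theorem exists_mem_ismDH_of_mem_latticeAut {φ : RescaledCompletion F p v hv ≃ₗ[ℚ_[p]] RescaledCompletion F p v hv}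
    (hφ : φ ∈ latticeAut ℚ_[p] (PadicModule.basisLattice p B).toIntSubmodule) :
    ∃ g ∈ ismDH logv (.inr v), ∀ a, toR p v hv (g (ofR p v hv a)) = φ a := by
  haveI := finiteDimensional_rescaledCompletion p v hv
  let g₀ : Carrier (.inr v : Place F) →+ Carrier (.inr v : Place F) := φ.toAddEquiv.toAddMonoidHom
  let g : Carrier (.inr v : Place F) ≃ₗ[ℚ] Carrier (.inr v : Place F) :=
    { g₀.toRatLinearMap with
      invFun := φ.symm
      left_inv := φ.left_inv
      right_inv := φ.right_inv }
  have hφc : Continuous φ := φ.toLinearMap.continuous_of_finiteDimensional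
  have hφc' : Continuous φ.symm := φ.symm.toLinearMap.continuous_of_finiteDimensional
  have hshell : (shell logv (.inr v) : Set (Carrier (.inr v : Place F))) =
      ((pStar p : ℕ) : ℚ_[p])⁻¹ • (logUnits (RescaledCompletion F p v hv) : Set (RescaledCompletion F p v hv)) :=
    Set.ext fun a => mem_shell_iff_mem_smul_logUnits v hv hlog a
  refine ⟨g, ⟨hφc, hφc', ?_⟩, fun a => rfl⟩
  rw [hshell, hΛ]
  exact PadicModule.image_smul_basisLattice_of_mem p B hφ _

/-- **(Ind2)-elements are lattice automorphisms**: an element `g ∈ Real.ismDH logv (inr v)` — a bicontinuous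
`ℚ`-linear automorphism of `K_v` fixing `I_v` — is `ℚ_p`-linear (continuity; campaign-S
`map_padic_smul_of_continuous`: `ℚ` is dense in `ℚ_p`) and maps `log_p(𝒪_v^×) = p^*·I_v` onto itself: read in the
rescaled completion it IS an element of `Aut_{ℚ_p}(K_v : log_p(𝒪_v^×))`. [cite: DupuyHilado2025, §4.9]
[cite: BourbakiAlgebraI1989, Ch. II §3 no. 3 Prop. 2] -/
theorem exists_mem_latticeAut_of_mem_ismDH {g : Carrier (.inr v : Place F) ≃ₗ[ℚ] Carrier (.inr v : Place F)}
    (hg : g ∈ ismDH logv (.inr v)) :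
    ∃ φ : RescaledCompletion F p v hv ≃ₗ[ℚ_[p]] RescaledCompletion F p v hv,
      φ ∈ latticeAut ℚ_[p] (PadicModule.basisLattice p B).toIntSubmodule ∧
        ∀ a, φ a = toR p v hv (g (ofR p v hv a)) := by
  set K := RescaledCompletion F p v hv
  obtain ⟨hgc, hgc', hgshell⟩ := hg
  -- `g` read on `K` (the same type) as an additive map; it is continuous there (same topology)
  let f : K →+ K :=
    { toFun := fun a => toR p v hv (g (ofR p v hv a))
      map_zero' := g.map_zero
      map_add' := fun a b => g.map_add a b }
  have hfc : Continuous f := hgc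
  have hf_smul : ∀ (c : ℚ_[p]) (x : K), f (c • x) = c • f x := fun c x => map_padic_smul_of_continuous p f hfc c x
  let φ : K ≃ₗ[ℚ_[p]] K :=
    { toFun := f
      map_add' := f.map_add
      map_smul' := hf_smul
      invFun := fun a => toR p v hv (g.symm (ofR p v hv a))
      left_inv := g.left_inv
      right_inv := g.right_inv }
  have hφf : ∀ a, φ a = toR p v hv (g (ofR p v hv a)) := fun a => rfl
  -- `φ` maps the shell `c • Λ`, `c = (p^*)⁻¹`, onto itself
  set c : ℚ_[p] := ((pStar p : ℕ) : ℚ_[p])⁻¹ with hc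
  have hc0 : c ≠ 0 := inv_ne_zero (Nat.cast_ne_zero.mpr (pStar_ne_zero hp.out.ne_zero))
  have hmem : ∀ a : K, a ∈ c • (PadicModule.basisLattice p B : Set K) ↔
      ofR p v hv a ∈ shell logv (.inr v) := fun a => by
    rw [← hΛ]; exact (mem_shell_iff_mem_smul_logUnits v hv hlog a).symm
  have hφshell : ∀ a : K, φ a ∈ c • (PadicModule.basisLattice p B : Set K) ↔
      a ∈ c • (PadicModule.basisLattice p B : Set K) := by
    intro a
    rw [hmem, hmem]
    -- `g (ofR a) ∈ shell ↔ ofR a ∈ shell` from `g '' shell = shell`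
    constructor
    · intro h
      have h' : g (ofR p v hv a) ∈ (g : Carrier (.inr v : Place F) → Carrier (.inr v : Place F)) ''
          shell logv (.inr v) := by rw [hgshell]; exact h
      obtain ⟨b, hb, hbe⟩ := h'
      rwa [← g.injective hbe]
    · intro h
      have h' : g (ofR p v hv a) ∈ (g : Carrier (.inr v : Place F) → Carrier (.inr v : Place F)) ''
          shell logv (.inr v) := ⟨_, h, rfl⟩
      rwa [hgshell] at h'
  -- descale: `φ x ∈ Λ ↔ x ∈ Λ` via `x ∈ Λ ↔ c • x ∈ c • Λ`
  have hsc : ∀ x : K, x ∈ (PadicModule.basisLattice p B : Set K) ↔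
      c • x ∈ c • (PadicModule.basisLattice p B : Set K) := fun x => (Set.smul_mem_smul_set_iff₀ hc0 _ _).symm
  refine ⟨φ, fun x => ?_, hφf⟩
  show φ x ∈ PadicModule.basisLattice p B ↔ x ∈ PadicModule.basisLattice p B
  rw [← SetLike.mem_coe, ← SetLike.mem_coe, hsc, hsc, ← LinearEquiv.map_smul, hφshell]

/-- The dictionary in «for all» form: a property of self-maps of `K_v` holds for the action of every
`g ∈ Real.ismDH logv (inr v)` iff it holds for every `φ ∈ Aut_{ℚ_p}(K_v : log_p(𝒪_v^×))`. [cite: DupuyHilado2025, §4.9] -/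
theorem forall_ismDH_iff_forall_latticeAut (P : (RescaledCompletion F p v hv → RescaledCompletion F p v hv) → Prop) :
    (∀ g ∈ ismDH logv (.inr v), P fun a => toR p v hv (g (ofR p v hv a))) ↔
      ∀ φ ∈ latticeAut ℚ_[p] (PadicModule.basisLattice p B).toIntSubmodule,
        P (φ : RescaledCompletion F p v hv ≃ₗ[ℚ_[p]] RescaledCompletion F p v hv) := by
  constructor
  · intro h φ hφ
    obtain ⟨g, hg, hgφ⟩ := exists_mem_ismDH_of_mem_latticeAut hlog B hΛ hφ
    have hfun : (fun a => toR p v hv (g (ofR p v hv a))) = φ := funext hgφ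
    exact hfun ▸ h g hg
  · intro h g hg
    obtain ⟨φ, hφ, hφg⟩ := exists_mem_latticeAut_of_mem_ismDH hlog B hΛ hg
    have hfun : (fun a => toR p v hv (g (ofR p v hv a))) = φ := (funext hφg).symm
    rw [hfun]
    exact h φ hφ

end Dictionary

/-! ## 3. The criterion -/

/-- **BALL-MOVER CRITERION.** At a finite place `v | p` with the analytic logarithm, for `t ≠ 0` in `K_v`:
EVERY element of Dupuy–Hilado's (Ind2) group `Real.ismDH logv (inr v)` maps the ball `t·𝒪_v = {‖y‖ ≤ ‖t‖}` onto
itself **iff** `{‖y‖ ≤ ‖t‖} = p^k · log_p(𝒪_v^×)` for some `k ∈ ℤ` (the `GL_{ℤ_p}(Λ)`-stable lattices are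
exactly `p^ℤ·Λ`, Weil *BNT* II §2). Valid at every residue characteristic and every ramification index.
[cite: DupuyHilado2025, §4.9] [cite: WeilBNT1967, Ch. II §2, Th. 1–2] -/
theorem forall_ismDH_image_closedBall_eq_iff {t : RescaledCompletion F p v hv} (ht : t ≠ 0) :
    (∀ g ∈ ismDH logv (.inr v),
        (fun a => toR p v hv (g (ofR p v hv a))) '' closedBall (0 : RescaledCompletion F p v hv) ‖t‖ =
          closedBall 0 ‖t‖) ↔
      ∃ k : ℤ, closedBall (0 : RescaledCompletion F p v hv) ‖t‖ =
        ((p : ℚ_[p]) ^ k) • (logUnits (RescaledCompletion F p v hv) : Set (RescaledCompletion F p v hv)) := by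
  obtain ⟨n, hn, B, hΛ⟩ := exists_basis_coe_logUnits_eq (p := p) v hv
  rw [forall_ismDH_iff_forall_latticeAut hlog B hΛ fun ψ => ψ '' closedBall (0 : RescaledCompletion F p v hv) ‖t‖ =
      closedBall 0 ‖t‖, hΛ]
  exact PadicModule.forall_image_closedBall_eq_iff p B (norm_pos_iff.2 ht)

/-- **Negative half (the MOVER): a ball `t·𝒪_v` that is no `p^k·log_p(𝒪_v^×)` is moved by some (Ind2)-element.**
[cite: DupuyHilado2025, §4.9] [cite: WeilBNT1967, Ch. II §2, Th. 1–2] -/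
theorem exists_mem_ismDH_image_closedBall_ne_of_forall_ne {t : RescaledCompletion F p v hv} (ht : t ≠ 0)
    (hne : ∀ k : ℤ, closedBall (0 : RescaledCompletion F p v hv) ‖t‖ ≠
      ((p : ℚ_[p]) ^ k) • (logUnits (RescaledCompletion F p v hv) : Set (RescaledCompletion F p v hv))) :
    ∃ g ∈ ismDH logv (.inr v),
      (fun a => toR p v hv (g (ofR p v hv a))) '' closedBall (0 : RescaledCompletion F p v hv) ‖t‖ ≠
        closedBall 0 ‖t‖ := by
  by_contra h
  push Not at h
  exact (forall_ismDH_image_closedBall_eq_iff hlog v hv ht).1 h |>.elim fun k hk => hne k hk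

/-- **Positive half**: a ball equal to some `p^k·log_p(𝒪_v^×)` is fixed by every (Ind2)-element.
[cite: DupuyHilado2025, §4.9] [cite: WeilBNT1967, Ch. II §2, Th. 1] -/
theorem forall_ismDH_image_closedBall_eq_of_eq_zpow_smul {t : RescaledCompletion F p v hv} (ht : t ≠ 0) {k : ℤ}
    (hk : closedBall (0 : RescaledCompletion F p v hv) ‖t‖ =
      ((p : ℚ_[p]) ^ k) • (logUnits (RescaledCompletion F p v hv) : Set (RescaledCompletion F p v hv))) :
    ∀ g ∈ ismDH logv (.inr v),
      (fun a => toR p v hv (g (ofR p v hv a))) '' closedBall (0 : RescaledCompletion F p v hv) ‖t‖ =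
        closedBall 0 ‖t‖ :=
  (forall_ismDH_image_closedBall_eq_iff hlog v hv ht).2 ⟨k, hk⟩

/-! ## 4. Consequences needing no computation of `log_p(𝒪_v^×)` -/

/-- **Two (Ind2)-fixed balls have radii in ratio `p^ℤ`.** [cite: WeilBNT1967, Ch. II §2, Th. 2]
[cite: DupuyHilado2025, §4.9] -/
theorem exists_norm_eq_zpow_mul_norm_of_forall_ismDH {t t' : RescaledCompletion F p v hv} (ht : t ≠ 0)
    (ht' : t' ≠ 0)
    (h : ∀ g ∈ ismDH logv (.inr v),
      (fun a => toR p v hv (g (ofR p v hv a))) '' closedBall (0 : RescaledCompletion F p v hv) ‖t‖ =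
        closedBall 0 ‖t‖)
    (h' : ∀ g ∈ ismDH logv (.inr v),
      (fun a => toR p v hv (g (ofR p v hv a))) '' closedBall (0 : RescaledCompletion F p v hv) ‖t'‖ =
        closedBall 0 ‖t'‖) :
    ∃ m : ℤ, ‖t'‖ = (p : ℝ) ^ m * ‖t‖ := by
  obtain ⟨n, hn, B, hΛ⟩ := exists_basis_coe_logUnits_eq (p := p) v hv
  have h1 := (forall_ismDH_iff_forall_latticeAut hlog B hΛ fun ψ =>
    ψ '' closedBall (0 : RescaledCompletion F p v hv) ‖t‖ = closedBall 0 ‖t‖).1 h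
  have h2 := (forall_ismDH_iff_forall_latticeAut hlog B hΛ fun ψ =>
    ψ '' closedBall (0 : RescaledCompletion F p v hv) ‖t'‖ = closedBall 0 ‖t'‖).1 h'
  exact PadicModule.exists_norm_eq_zpow_mul_norm_of_forall_image_closedBall_eq p B ht ht' h1 h2

/-- **Of two balls with radii ratio outside `p^ℤ`, at least one is moved by (Ind2).**
[cite: WeilBNT1967, Ch. II §2, Th. 2] [cite: DupuyHilado2025, §4.9] -/
theorem exists_mem_ismDH_image_closedBall_ne_or {t t' : RescaledCompletion F p v hv} (ht : t ≠ 0) (ht' : t' ≠ 0)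
    (hratio : ∀ m : ℤ, ‖t'‖ ≠ (p : ℝ) ^ m * ‖t‖) :
    (∃ g ∈ ismDH logv (.inr v),
        (fun a => toR p v hv (g (ofR p v hv a))) '' closedBall (0 : RescaledCompletion F p v hv) ‖t‖ ≠
          closedBall 0 ‖t‖) ∨
      ∃ g ∈ ismDH logv (.inr v),
        (fun a => toR p v hv (g (ofR p v hv a))) '' closedBall (0 : RescaledCompletion F p v hv) ‖t'‖ ≠
          closedBall 0 ‖t'‖ := by
  by_contra hc
  push Not at hc
  exact (exists_norm_eq_zpow_mul_norm_of_forall_ismDH hlog v hv ht ht' hc.1 hc.2).elim fun m hm => hratio m hm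

/-- **Uniformizer form: `e(v|p) ∤ i` ⇒ of `t·𝒪_v` and `t·ϖ^i·𝒪_v` at least one is moved by (Ind2)** — so among
the balls `t·ϖ^i·𝒪_v`, `i mod e(v|p)`, AT MOST ONE class is (Ind2)-fixed; valid at wild places too.
[cite: WeilBNT1967, Ch. II §2, Th. 2] [cite: DupuyHilado2025, §4.9] [cite: NeukirchANT1999, Ch. II Prop. (6.8)] -/
theorem exists_mem_ismDH_image_closedBall_ne_or_of_not_dvd {ϖ : (RescaledCompletion F p v hv)ˣ}
    (hϖ : IsUniformizer ϖ) {t : RescaledCompletion F p v hv} (ht : t ≠ 0) {i : ℤ}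
    (hi : ¬ ((v.asIdeal.ramificationIdx ℤ : ℕ) : ℤ) ∣ i) :
    (∃ g ∈ ismDH logv (.inr v),
        (fun a => toR p v hv (g (ofR p v hv a))) '' closedBall (0 : RescaledCompletion F p v hv) ‖t‖ ≠
          closedBall 0 ‖t‖) ∨
      ∃ g ∈ ismDH logv (.inr v),
        (fun a => toR p v hv (g (ofR p v hv a))) ''
            closedBall (0 : RescaledCompletion F p v hv) ‖t * (ϖ : RescaledCompletion F p v hv) ^ i‖ ≠
          closedBall 0 ‖t * (ϖ : RescaledCompletion F p v hv) ^ i‖ := by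
  obtain ⟨n, hn, B, hΛ⟩ := exists_basis_coe_logUnits_eq (p := p) v hv
  rw [← absRamificationIdx_rescaledCompletion F p v hv] at hi
  have h := PadicModule.exists_latticeAut_image_closedBall_ne_or_of_not_dvd p B hϖ ht hi
  -- translate both disjuncts through the dictionary (contrapositive form)
  by_contra hc
  push Not at hc
  obtain ⟨h1, h2⟩ := hc
  have h1' := (forall_ismDH_iff_forall_latticeAut hlog B hΛ fun ψ =>
    ψ '' closedBall (0 : RescaledCompletion F p v hv) ‖t‖ = closedBall 0 ‖t‖).1 h1
  have h2' := (forall_ismDH_iff_forall_latticeAut hlog B hΛ fun ψ =>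
    ψ '' closedBall (0 : RescaledCompletion F p v hv) ‖t * (ϖ : RescaledCompletion F p v hv) ^ i‖ =
      closedBall 0 ‖t * (ϖ : RescaledCompletion F p v hv) ^ i‖).1 h2
  rcases h with ⟨φ, hφ, hne⟩ | ⟨φ, hφ, hne⟩
  · exact hne (h1' φ hφ)
  · exact hne (h2' φ hφ)

/-- **At EVERY ramified place (`e(v|p) ≥ 2`), for every `t ≠ 0`: `t·𝒪_v` or `t·ϖ·𝒪_v` is moved by (Ind2)**
(the case `i = 1`; any residue characteristic, wild ramification included — refines abc-iut-c312-5's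
`exists_mem_ismDH_image_closedBall_ne`, p429534). [cite: WeilBNT1967, Ch. II §2, Th. 2] [cite: DupuyHilado2025, §4.9] -/
theorem exists_mem_ismDH_image_closedBall_ne_or_of_two_le {ϖ : (RescaledCompletion F p v hv)ˣ}
    (hϖ : IsUniformizer ϖ) (he : 2 ≤ v.asIdeal.ramificationIdx ℤ) {t : RescaledCompletion F p v hv} (ht : t ≠ 0) :
    (∃ g ∈ ismDH logv (.inr v),
        (fun a => toR p v hv (g (ofR p v hv a))) '' closedBall (0 : RescaledCompletion F p v hv) ‖t‖ ≠
          closedBall 0 ‖t‖) ∨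
      ∃ g ∈ ismDH logv (.inr v),
        (fun a => toR p v hv (g (ofR p v hv a))) ''
            closedBall (0 : RescaledCompletion F p v hv) ‖t * (ϖ : RescaledCompletion F p v hv)‖ ≠
          closedBall 0 ‖t * (ϖ : RescaledCompletion F p v hv)‖ := by
  have h := exists_mem_ismDH_image_closedBall_ne_or_of_not_dvd hlog v hv hϖ ht (i := 1) (by
    intro hd
    have h1 := Int.eq_one_of_dvd_one (by positivity) hd
    omega)
  rwa [zpow_one] at h

/-! ## 5. The tame evaluation: `log_p(𝒪_v^×) = 𝔪_v` -/

section Tame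

variable {v hv}

omit hlog in
/-- **Tame places: `log_p(𝒪_v^×) = 𝔪_v = {‖y‖ ≤ ‖ϖ‖}`** for `p > 2`, `e(v|p) ≤ p − 2` ([IUTchIV] Prop. 1.2 (i),
equality clause `log_p(R^×) = p^{1/e}·R`; campaign-S `prop12iEq_holds`; `‖ϖ‖ = p^{−1/e}`).
[cite: NeukirchANT1999, Ch. II Prop. (5.5)] [claim: Mochizuki2012, status: disputed] -/
theorem logUnits_eq_closedBall_of_tame (hp2 : 2 < p) (he : v.asIdeal.ramificationIdx ℤ ≤ p - 2)
    {ϖ : (RescaledCompletion F p v hv)ˣ} (hϖ : IsUniformizer ϖ) :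
    logUnits (RescaledCompletion F p v hv) =
      closedBall (0 : RescaledCompletion F p v hv) ‖(ϖ : RescaledCompletion F p v hv)‖ := by
  set K := RescaledCompletion F p v hv
  have heK : absRamificationIdx p K = v.asIdeal.ramificationIdx ℤ := absRamificationIdx_rescaledCompletion F p v hv
  have he' : absRamificationIdx p K ≤ p - 2 := by rw [heK]; exact he
  have he1 : 1 ≤ absRamificationIdx p K := absRamificationIdx_pos p K
  have h := (prop12iEq_holds p K hp2 he').1
  rw [← h, pBall_eq_closedBall, norm_eq_rpow_of_isUniformizer p K hϖ, logRadiusA_eq hp2 he1 he']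

/-- **TAME CRITERION (all `e`, all `f`).** At a place `v | p` with `p > 2`, `e := e(v|p) ≤ p − 2`, for a
uniformizer `ϖ` and `j ∈ ℤ`: EVERY (Ind2)-element fixes the ball `{‖y‖ ≤ ‖ϖ‖^j} = 𝔪_v^j` **iff `e ∣ (j − 1)`**;
equivalently the ball `t·𝒪_v` is MOVED by some (Ind2)-element iff `ord_v(t) ≢ 1 (mod e)` (abc-iut-w5-d216's
predicted criterion; p421508 is the case `e = 2`, `f = 1`, `j` even). [cite: DupuyHilado2025, §4.9]
[cite: WeilBNT1967, Ch. II §2, Th. 2] [cite: NeukirchANT1999, Ch. II Prop. (5.5)] -/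
theorem forall_ismDH_image_closedBall_eq_iff_dvd (hp2 : 2 < p) (he : v.asIdeal.ramificationIdx ℤ ≤ p - 2)
    {ϖ : (RescaledCompletion F p v hv)ˣ} (hϖ : IsUniformizer ϖ) (j : ℤ) :
    (∀ g ∈ ismDH logv (.inr v),
        (fun a => toR p v hv (g (ofR p v hv a))) ''
            closedBall (0 : RescaledCompletion F p v hv) ‖(ϖ : RescaledCompletion F p v hv) ^ j‖ =
          closedBall 0 ‖(ϖ : RescaledCompletion F p v hv) ^ j‖) ↔
      ((v.asIdeal.ramificationIdx ℤ : ℕ) : ℤ) ∣ (j - 1) := by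
  set K := RescaledCompletion F p v hv
  obtain ⟨n, hn, B, hΛ⟩ := exists_basis_coe_logUnits_eq (p := p) v hv
  have hball : (PadicModule.basisLattice p B : Set K) = closedBall 0 ‖(ϖ : K)‖ := by
    rw [← hΛ, logUnits_eq_closedBall_of_tame hp2 he hϖ]
  have hϖ0 : (ϖ : K) ^ j ≠ 0 := zpow_ne_zero _ ϖ.ne_zero
  have heK : absRamificationIdx p K = v.asIdeal.ramificationIdx ℤ := absRamificationIdx_rescaledCompletion F p v hv
  rw [forall_ismDH_iff_forall_latticeAut hlog B hΛ fun ψ => ψ '' closedBall (0 : K) ‖(ϖ : K) ^ j‖ =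
      closedBall 0 ‖(ϖ : K) ^ j‖,
    PadicModule.forall_image_closedBall_eq_iff_of_coe_eq_closedBall p B hball hϖ0, ← heK]
  -- `‖ϖ‖^j = p^m·‖ϖ‖ ↔ ‖ϖ‖^{j-1} = p^m`, and `‖ϖ‖^{j-1} ∈ p^ℤ ↔ e ∣ j - 1`
  have hn0 : ‖(ϖ : K)‖ ≠ 0 := norm_ne_zero_iff.2 ϖ.ne_zero
  have hnpos : 0 < ‖(ϖ : K)‖ := norm_pos_iff.2 ϖ.ne_zero
  have hp0 : (0 : ℝ) < p := by exact_mod_cast hp.out.pos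
  have hE := norm_pow_absRamificationIdx p K hϖ
  constructor
  · rintro ⟨m, hm⟩
    rw [norm_zpow] at hm
    have h1 : ‖(ϖ : K)‖ ^ (j - 1) = (p : ℝ) ^ m := by
      rw [zpow_sub_one₀ hn0, hm, mul_assoc, mul_inv_cancel₀ hn0, mul_one]
    exact PadicModule.dvd_of_norm_zpow_eq_zpow p hϖ h1
  · rintro ⟨q, hq⟩
    refine ⟨-q, ?_⟩
    rw [norm_zpow, show j = (absRamificationIdx p K : ℤ) * q + 1 by omega, zpow_add_one₀ hn0, zpow_mul,
      zpow_natCast, hE, inv_zpow', zpow_neg]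

/-- **Tame places, mover form**: for `t ≠ 0` of order `j = ord_v(t)` (`‖t‖ = ‖ϖ‖^j`) with `e(v|p) ∤ (j − 1)`,
some (Ind2)-element moves `t·𝒪_v`. [cite: DupuyHilado2025, §4.9] [cite: WeilBNT1967, Ch. II §2, Th. 2] -/
theorem exists_mem_ismDH_image_closedBall_ne_of_tame (hp2 : 2 < p) (he : v.asIdeal.ramificationIdx ℤ ≤ p - 2)
    {ϖ : (RescaledCompletion F p v hv)ˣ} (hϖ : IsUniformizer ϖ) {t : RescaledCompletion F p v hv} {j : ℤ}
    (ht : ‖t‖ = ‖(ϖ : RescaledCompletion F p v hv)‖ ^ j)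
    (hj : ¬ ((v.asIdeal.ramificationIdx ℤ : ℕ) : ℤ) ∣ (j - 1)) :
    ∃ g ∈ ismDH logv (.inr v),
      (fun a => toR p v hv (g (ofR p v hv a))) '' closedBall (0 : RescaledCompletion F p v hv) ‖t‖ ≠
        closedBall 0 ‖t‖ := by
  by_contra h
  push Not at h
  rw [ht, ← norm_zpow] at h
  exact hj ((forall_ismDH_image_closedBall_eq_iff_dvd hlog hp2 he hϖ j).1 h)

/-- **Unramified odd places: NO ball is moved** (`e(v|p) = 1 ≤ p − 2`; `1 ∣ j − 1`) — the balls-only shadow of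
abc-iut-w5-d216's isometry theorem p428821. [cite: DupuyHilado2025, §4.9] [cite: WeilBNT1967, Ch. II §2, Th. 2] -/
theorem forall_ismDH_image_closedBall_eq_of_unramified (hp2 : 2 < p) (he : v.asIdeal.ramificationIdx ℤ = 1)
    {t : RescaledCompletion F p v hv} (ht : t ≠ 0) :
    ∀ g ∈ ismDH logv (.inr v),
      (fun a => toR p v hv (g (ofR p v hv a))) '' closedBall (0 : RescaledCompletion F p v hv) ‖t‖ =
        closedBall 0 ‖t‖ := by
  obtain ⟨ϖ, hϖ, -⟩ := exists_isUniformizer_rescaledCompletion F p v hv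
  obtain ⟨j, hj⟩ := hϖ.2 (Units.mk0 t ht)
  have ht' : ‖t‖ = ‖(ϖ : RescaledCompletion F p v hv) ^ j‖ := by rw [norm_zpow]; exact hj
  rw [ht']
  refine (forall_ismDH_image_closedBall_eq_iff_dvd hlog hp2 (by rw [he]; omega) hϖ j).2 ?_
  rw [he]
  exact one_dvd _

end Tame

end Summit.ABC.IUTFork.Thm311.Real

end
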